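import Literature.Topology.FourManifolds.HCobordismThetaFiniteKMSurgery
import Literature.Topology.FourManifolds.ThetaFourKervaireMilnorBettiStep
import HarnessLib

/-!
# spc4.S13, `n ≡ 0 (mod 4)`: the middle-dimensional step of Kervaire–Milnor's Thm. 5.1 for `k`
# even, from Lemmas 5.3–5.4 alone

Topic `Literature/Topology/FourManifolds`; a corollary file joining
`HCobordismThetaFiniteKMSurgery.lean` (M. Kervaire, J. Milnor, *Groups of homotopy spheres I*,
Ann. of Math. (2) 77 (1963), proof of Thm. 5.1 for `k` even, pp. 515–519:
`HomotopySphere.exists_killMiddleHomology_of_surgeryLemmas_even`, which takes Lemmas 5.3–5.4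
(`h534`), Lemma 5.6 (`h56`), the Assertion of p. 516 with the duality step of Lemma 5.7 (`hkill`)
and Lemma 5.8 (`h58`) as hypotheses) with the theorems of the tree that discharge the three
homological ones for every even `k ≥ 2`:

* Lemma 5.6 — `FramedSphereFamily.nonempty_quotient_addEquiv_quotient_surgered`
  (`SphereSurgeryOddMiddleHomology.lean`);
* the Assertion + duality — `FramedSphereFamily.nonempty_addEquiv_quotient_surgered_of_epi` with
  `NullCobordism.epi_ofAbsolute_complement_of_exists_dual` (`SphereCorePrimitive.lean`);
* Lemma 5.8 (`k` even) — `NullCobordism.finrank_surgery_ne_of_even`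
  (`ThetaFourKervaireMilnorBettiStep.lean`: Thom's isotropy by Čech–Alexander duality,
  `TubeComplementDuality.lean`, `SphereSurgeryOddMiddleIsotropy.lean`, and the rank book-keeping of
  `SphereSurgeryOddMiddleRank.lean`).

* `HomotopySphere.exists_killMiddleHomology_even_of_lemma534` — **for `k ≥ 2` even and a homotopy
  `2k`-sphere `Σ`, GIVEN only Lemmas 5.3–5.4 (`h534`), every null-cobordism `W` of `Σ` satisfying
  the Hypothesis of p. 516 may be replaced by a simply connected `W₁`, `bW₁ = Σ`, with
  `Hᵢ(W₁; ℤ) = 0` for `0 < i ≤ k`;** `killMiddleHomology_even_of_lemma534` — the same in the shape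
  of the hypothesis `h66` (`n ≡ 0 (mod 4)`) of
  `finite_homotopySphereClass_of_kervaireMilnor_frontier_section5`.

Everything here is proved; no definition and no named fact is introduced (D-0026).

## References

* M. Kervaire, J. Milnor, *Groups of homotopy spheres I*, Ann. of Math. (2) 77 (1963), Hypothesis
  and Assertion p. 516, Lemmas 5.3–5.4, 5.6–5.8, proof of Thm. 5.1 for `k` even (pp. 513–519).
  doi:10.2307/1970128 [KervaireMilnorAnnals1963]
-/

noncomputable section

open scoped Manifold ContDiff Topology
open Set Function CategoryTheory CategoryTheory.Limits AddSubgroup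
open Literature.AlgebraicTopology.SingularHomology

namespace Literature.Topology.FourManifolds

namespace HomotopySphere

/-- **The middle-dimensional step of Thm. 5.1 for `k` even, from Lemmas 5.3–5.4 alone.** For
`k ≥ 2` even and a homotopy `2k`-sphere `Σ`: GIVEN (`h534`) Lemmas 5.3–5.4 with Hurewicz for the
null-cobordisms of `Σ` under the Hypothesis of p. 516 (every `λ ∈ HₖW` is `φ⁎[Sᵏ]` for a framed
imbedded `k`-sphere `φ` with `χ(W, φ)` s-parallelizable), every compact, simply connected,
s-parallelizable, `(k-1)`-connected `W` with `bW = Σ` may be replaced by a simply connected `W₁`,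
`bW₁ = Σ`, `Hᵢ(W₁; ℤ) = 0` for `0 < i ≤ k` — `exists_killMiddleHomology_of_surgeryLemmas_even` with
Lemma 5.6, the Assertion (+ Lemma 5.7's duality) and Lemma 5.8 supplied by the tree.
[cite: KervaireMilnorAnnals1963, proof of Thm. 5.1 for k even (pp. 515–519), Lemmas 5.6–5.8] -/
theorem exists_killMiddleHomology_even_of_lemma534 {k : ℕ} (hk : 2 ≤ k) (hke : Even k)
    (S : HomotopySphere (k + k))
    (h534 : ∀ c : NullCobordism (k + k) S.carrier, SimplyConnectedSpace c.W →
      IsStablyParallelizable (𝓡∂ (k + k + 1)) c.W →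
        (∀ i : ℕ, 0 < i → i < k → Subsingleton (singularHomology ℤ ℤ c.W i)) →
          ∀ x : singularHomology ℤ ℤ c.W k,
            ∃ (ν : FramedSphereFamily (𝓡∂ (k + k + 1)) c.W Unit k (k + 1))
              (θ : singularHomology ℤ ℤ (Metric.sphere (0 : EuclideanSpace ℝ (Fin (k + 1))) 1) k),
              AddSubgroup.zmultiples θ = ⊤ ∧ singularHomology.map ℤ ℤ ν.sphereMap k θ = x ∧
                IsStablyParallelizable (𝓡∂ (k + k + 1)) (c.surgery ν rfl).W)
    (c : NullCobordism (k + k) S.carrier) (hsc : SimplyConnectedSpace c.W)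
    (hpar : IsStablyParallelizable (𝓡∂ (k + k + 1)) c.W)
    (hconn : ∀ i : ℕ, 0 < i → i < k → Subsingleton (singularHomology ℤ ℤ c.W i)) :
    ∃ c₁ : NullCobordism (k + k) S.carrier, SimplyConnectedSpace c₁.W ∧
      ∀ i : ℕ, 0 < i → i ≤ k → Subsingleton (singularHomology ℤ ℤ c₁.W i) :=
  exists_killMiddleHomology_of_surgeryLemmas_even (by omega) S h534
    (fun c hsc' _ _ ν θ hθ => by
      haveI := hsc'
      exact ⟨_, FramedSphereFamily.nonempty_quotient_addEquiv_quotient_surgered (X := c.W) ν rfl hk hθ⟩)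
    (fun c hsc' _ _ ν θ hθ hf => by
      haveI := hsc'
      exact FramedSphereFamily.nonempty_addEquiv_quotient_surgered_of_epi (X := c.W) ν rfl hk hθ
        (NullCobordism.epi_ofAbsolute_complement_of_exists_dual S c ν rfl hk (by omega) (by omega)
          hθ hf))
    (fun c hsc' _ _ ν _ => by
      haveI := hsc'
      exact NullCobordism.finrank_surgery_ne_of_even hk hke S c ν)
    c hsc hpar hconn

end HomotopySphere

/-- **The hypothesis `h66` of `finite_homotopySphereClass_of_kervaireMilnor_frontier_section5` for
`n ≡ 0 (mod 4)`, from Lemmas 5.3–5.4 alone**: the shape of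
`killMiddleHomology_even_of_surgeryLemmas` with `h56`, `hkill`, `h58` discharged by the tree
(`HomotopySphere.exists_killMiddleHomology_even_of_lemma534`).
[cite: KervaireMilnorAnnals1963, proof of Thm. 5.1 for k even (pp. 515–519)] -/
theorem killMiddleHomology_even_of_lemma534
    (h534 : ∀ (k : ℕ) (S : HomotopySphere (k + k)) (c : NullCobordism (k + k) S.carrier), 1 < k →
      SimplyConnectedSpace c.W → IsStablyParallelizable (𝓡∂ (k + k + 1)) c.W →
        (∀ i : ℕ, 0 < i → i < k → Subsingleton (singularHomology ℤ ℤ c.W i)) →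
          ∀ x : singularHomology ℤ ℤ c.W k,
            ∃ (ν : FramedSphereFamily (𝓡∂ (k + k + 1)) c.W Unit k (k + 1))
              (θ : singularHomology ℤ ℤ (Metric.sphere (0 : EuclideanSpace ℝ (Fin (k + 1))) 1) k),
              AddSubgroup.zmultiples θ = ⊤ ∧ singularHomology.map ℤ ℤ ν.sphereMap k θ = x ∧
                IsStablyParallelizable (𝓡∂ (k + k + 1)) (c.surgery ν rfl).W)
    (n k : ℕ) (S : HomotopySphere n) (c : NullCobordism n S.carrier) (hn : 5 ≤ n)
    (hnk : n = 2 * k) (heven : Even k) (hsc : SimplyConnectedSpace c.W)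
    (hpar : IsStablyParallelizable (𝓡∂ (n + 1)) c.W)
    (hconn : ∀ i : ℕ, 0 < i → i < k → Subsingleton (singularHomology ℤ ℤ c.W i)) :
    ∃ c₁ : NullCobordism n S.carrier, SimplyConnectedSpace c₁.W ∧
      ∀ i : ℕ, 0 < i → i ≤ k → Subsingleton (singularHomology ℤ ℤ c₁.W i) := by
  obtain rfl : n = k + k := by omega
  have hk : 2 ≤ k := by omega
  exact HomotopySphere.exists_killMiddleHomology_even_of_lemma534 hk heven S
    (fun c => h534 k S c (by omega)) c hsc hpar hconn

end Literature.Topology.FourManifolds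

end
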